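import Literature.Computability.Cryptography.WordRAMInline3
import HarnessLib

/-!
# The word RAM — inline simulation of oracle calls, IV: unboundedly many oracle calls

The simulating machine `Inline.SIM` of `…WordRAMInline3` (V. Vassilevska Williams, ICM 2018, §2,
the remark after Def. 2.1: run the reduction and "replace the oracle calls by the corresponding runs
of the algorithm") invalidates the scratch memory of the inlined oracle algorithm by *generation
stamps*: register `10` counts the oracle calls made so far, and the specification `run_SIM`
therefore carries the hypothesis `t + 2 ≤ 2 ^ W` — the running time of the reduction must fit in a
word. For reductions whose time budget exceeds the word capacity — a fine-grained reduction from
`(CNFSATWithSize c, 2ⁿ)` runs for `2^{ρ n}` steps at `O(log n)`-bit words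
(`Literature.Computability.FineGrained.NSETHNonReducibilityAPSP`) — this hypothesis fails. This file
builds the variant `SIM'` and proves its specification `run_SIM'` / `outputsWithin_SIM'` /
`haltsWithin_SIM'` WITHOUT that hypothesis:

* `WPRE pos` (12 instructions), the **wipe prefix** of every query block: if the generation register
  has reached `2Q` (`Q = 2 ^ (W - 2)`, held as `2Q`, `3Q` in registers `8`, `9`), zero the whole
  stamp quarter `[3Q, 4Q)` — `Q - 1` cells by the zeroing loop of `…WordRAMBlocks` (whose pointer
  must not wrap, `run_zeroLoop`), the last cell `4Q - 1` directly — and reset the generation to `0`;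
  `run_WPRE`: cost `≤ wpreCost W = 5Q + 8`, the `B`-side between calls (`BPre`) is re-established at
  a generation `< 2Q`, only registers `10, 15, 16, 17` and the stamp quarter change, values stay
  below `2 ^ W`;
* `QB' = WPRE ++ QB` and `run_QB'`: the query block of part II behind the wipe, entered at any
  generation `≤ 2Q` and left at one `≤ 2Q`, so that the bound `g + 1 ≤ 2 ^ W - 1` of `run_QB` is
  always met;
* `SIM' M k M_B k_B = PRO k ++ compile … (QB' M_B k_B) ++ EPI …` with the invariant `SimInv'`
  (the generation is SOME `g ≤ 2Q`, no longer the number of queries), `sim_step'`, `sim_run'`,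
  `run_SIM'`: the prologue, the emulator of `M` (`…WordRAMEmulator.emu_step`, generic in the query
  block), the query block proper and the epilogue are reused verbatim from parts I–III. The cost is
  `simCost' |x| W t (Σ_q charge' q) |output|` with `charge' q = wpreCost W + qbCost …` — the wipe is
  charged, crudely, to every query (it actually happens once in `2Q` queries); in the intended
  application `2 ^ W = poly(n)` per query is affordable, and no amortisation argument is needed.

## References

* V. Vassilevska Williams, *On some fine-grained questions in algorithms and complexity*,
  Proc. ICM 2018, §2 (Def. 2.1 and the remark following it).
* T. Hagerup, *Sorting and searching on the word RAM*, STACS 1998, §2.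
-/

namespace Literature.Computability.Cryptography.WordRAM

open StateTransition

namespace Inline

/-! ## The wipe prefix -/

/-- The test operation of the wipe: `r15 := (r10 = r8)`. [folklore] -/
def wpreTest : List OpSpec :=
  [(.eq, .dir 15, .dir 10, .dir 8)]

/-- The three set-up operations of the wipe: `r16 := r8 / 2 (= Q)`, `r16 := r16 - 1`,
`r17 := r9 (= 3Q)`. [folklore] -/
def wpreSetup : List OpSpec :=
  [(.div, .dir 16, .dir 8, .imm 2), (.sub, .dir 16, .dir 16, .imm 1), (.add, .dir 17, .dir 9, .imm 0)]

/-- The two closing operations of the wipe: zero the last stamp cell `mem[r17] (= 4Q - 1)` and reset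
the generation register `r10 := 0`. [folklore] -/
def wpreClose : List OpSpec :=
  [(.add, .ind 17, .imm 0, .imm 0), (.add, .dir 10, .imm 0, .imm 0)]

/-- **The wipe prefix** at position `pos` (12 instructions): `r15 := (r10 = r8)`; if `r15 = 0`
(the generation is not yet `2Q`) jump to `pos + 12`; otherwise `r16 := Q - 1`, `r17 := 3Q`, zero
the `Q - 1` cells `[3Q, 4Q - 1)` (`zeroLoop`, leaving `r17 = 4Q - 1`), zero cell `4Q - 1`, and
`r10 := 0`. Registers `15, 16, 17` are temporaries of this file. [folklore] -/
def WPRE (pos : ℕ) : List Instr :=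
  wpreTest.map OpSpec.toInstr ++ [.jz (.dir 15) (pos + 12)] ++ wpreSetup.map OpSpec.toInstr ++
    zeroLoop (pos + 5) 16 17 ++ wpreClose.map OpSpec.toInstr

/-- The wipe prefix has 12 instructions. [folklore] -/
@[simp] theorem WPRE_length (pos : ℕ) : (WPRE pos).length = 12 := by
  simp [WPRE, wpreTest, wpreSetup, wpreClose]

/-- The cost of the wipe prefix. [folklore] -/
def wpreCost (W : ℕ) : ℕ := 5 * Qv W + 8

section wpre

variable {W : ℕ}

/-- The test operation, computed. [folklore] -/
theorem execOps_wpreTest (mem : ℕ → ℕ) :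
    execOps W mem wpreTest = Function.update mem 15 (if mem 10 = mem 8 then 1 else 0) :=
  rfl

/-- The set-up operations, computed (registers `8, 9` holding `2Q, 3Q`, `W ≥ 8`). [folklore] -/
theorem execOps_wpreSetup (hW : 8 ≤ W) {mem : ℕ → ℕ} (h8 : mem 8 = 2 * Qv W)
    (h9 : mem 9 = 3 * Qv W) :
    execOps W mem wpreSetup =
      Function.update (Function.update mem 16 (Qv W - 1)) 17 (3 * Qv W) := by
  have hQ := Qv_ge hW
  have h4Q := four_mul_Qv (show 2 ≤ W by omega)
  have h1mod : 1 % 2 ^ W = 1 := Nat.mod_eq_of_lt (by omega)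
  have hdiv : 2 * Qv W / 2 = Qv W := by omega
  have hsub : (Qv W + 2 ^ W - 1) % 2 ^ W = Qv W - 1 := by
    rw [show Qv W + 2 ^ W - 1 = (Qv W - 1) + 2 ^ W by omega, Nat.add_mod_right,
      Nat.mod_eq_of_lt (by omega)]
  have hadd : 3 * Qv W % 2 ^ W = 3 * Qv W := Nat.mod_eq_of_lt (by omega)
  -- unfold the three operations
  show execOp W (execOp W (execOp W mem (.div, .dir 16, .dir 8, .imm 2))
      (.sub, .dir 16, .dir 16, .imm 1)) (.add, .dir 17, .dir 9, .imm 0) = _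
  have e1 : execOp W mem (.div, .dir 16, .dir 8, .imm 2) = Function.update mem 16 (Qv W) := by
    show Function.update mem 16 (mem 8 / 2) = _
    rw [h8, hdiv]
  rw [e1]
  have e2 : execOp W (Function.update mem 16 (Qv W)) (.sub, .dir 16, .dir 16, .imm 1) =
      Function.update mem 16 (Qv W - 1) := by
    show Function.update (Function.update mem 16 (Qv W)) 16
        ((Function.update mem 16 (Qv W) 16 + 2 ^ W - 1 % 2 ^ W) % 2 ^ W) = _
    rw [Function.update_self, h1mod, hsub, Function.update_idem]
  rw [e2]
  show Function.update (Function.update mem 16 (Qv W - 1)) 17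
      ((Function.update mem 16 (Qv W - 1) 9 + 0) % 2 ^ W) = _
  rw [Function.update_of_ne (show (9 : ℕ) ≠ 16 by decide), h9, Nat.add_zero, hadd]

/-- The closing operations, computed (register `17` holding the last stamp address). [folklore] -/
theorem execOps_wpreClose {mem : ℕ → ℕ} {p : ℕ} (h17 : mem 17 = p) :
    execOps W mem wpreClose = Function.update (Function.update mem p 0) 10 0 := by
  simp [wpreClose, execOps, execOp, Operand.write, BinOp.eval, h17]

variable {P : Program} {pos : ℕ} {O : List ℕ → List ℕ} {ρ : ℕ → ℕ}

/-- **Specification of the wipe prefix.** From `pc = pos` with the `B`-side between calls at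
generation `g ≤ 2Q` (register `10`), the prefix reaches `pc = pos + 12` within `wpreCost W` steps in a
configuration whose `B`-side is between calls at some generation `g' < 2Q` (again in register `10`),
whose memory differs from the old one only in registers `10, 15, 16, 17` and the stamp quarter
`[3Q, 4Q)`, stays `VT`-bounded (`VT = 2 ^ W - 1`), and whose coins and query log are unchanged. [folklore] -/
theorem run_WPRE (hcode : CodeAt P pos (WPRE pos)) (hW : 8 ≤ W) {VT : ℕ} (hVT : VT + 1 = 2 ^ W)
    {e : Cfg} (hpc : e.pc = some pos) (hT : MemLE VT e.mem) {g : ℕ} (hB : BPre W g e.mem)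
    (h10 : e.mem 10 = g) (hg : g ≤ 2 * Qv W) :
    ∃ n, n ≤ wpreCost W ∧ ∃ e' : Cfg, run P W O ρ n e = some e' ∧ e'.pc = some (pos + 12) ∧
      (∃ g', g' < 2 * Qv W ∧ BPre W g' e'.mem ∧ e'.mem 10 = g') ∧ MemLE VT e'.mem ∧
      (∀ c, ¬ (c = 10 ∨ c = 15 ∨ c = 16 ∨ c = 17 ∨ (3 * Qv W ≤ c ∧ c < 4 * Qv W)) →
        e'.mem c = e.mem c) ∧
      e'.coinPos = e.coinPos ∧ e'.queries = e.queries := by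
  have hQ := Qv_ge hW
  have h4Q := four_mul_Qv (show 2 ≤ W by omega)
  obtain ⟨h8, h9, hst⟩ := hB
  -- code placement
  simp only [WPRE] at hcode
  obtain ⟨hc0123, hc4⟩ := codeAt_append_iff.1 hcode
  obtain ⟨hc012, hc3⟩ := codeAt_append_iff.1 hc0123
  obtain ⟨hc01, hc2⟩ := codeAt_append_iff.1 hc012
  obtain ⟨hc0, hc1⟩ := codeAt_append_iff.1 hc01
  simp only [List.length_map, List.length_cons, List.length_nil, List.length_append,
    zeroLoop_length, wpreSetup, wpreTest, Nat.reduceAdd] at hc1 hc2 hc3 hc4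
  -- step 1: the test
  have hr1 := run_ops (P := P) (w := W) (O := O) (ρ := ρ) wpreTest hc0 hpc
  set mem₁ : ℕ → ℕ := execOps W e.mem wpreTest with hmem₁def
  have hmem₁ : mem₁ = Function.update e.mem 15 (if g = 2 * Qv W then 1 else 0) := by
    rw [hmem₁def, execOps_wpreTest, h10, h8]
  have hlen₁ : wpreTest.length = 1 := rfl
  rw [hlen₁] at hr1
  have hjz : P[pos + 1]? = some (.jz (.dir 15) (pos + 12)) := hc1.getElem?_zero
  -- common facts about `mem₁`
  have hm₁8 : mem₁ 8 = 2 * Qv W := by rw [hmem₁, Function.update_of_ne (by decide), h8]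
  have hm₁9 : mem₁ 9 = 3 * Qv W := by rw [hmem₁, Function.update_of_ne (by decide), h9]
  have hm₁T : MemLE VT mem₁ := fun a => by
    rw [hmem₁]
    rcases eq_or_ne a 15 with rfl | ha
    · rw [Function.update_self]; split <;> omega
    · rw [Function.update_of_ne ha]; exact hT a
  by_cases hgQ : g = 2 * Qv W
  · -- the wipe branch
    have h15 : (Operand.dir 15).read mem₁ ≠ 0 := by simp [hmem₁, hgQ]
    have hr2 : run P W O ρ 1 { e with pc := some (pos + 1), mem := mem₁ } =
        some { e with pc := some (pos + 2), mem := mem₁ } := by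
      rw [run_one, step_jz_ne (i := pos + 1) rfl hjz h15]
    -- steps 3–5: set-up
    have hr3 := run_ops (P := P) (w := W) (O := O) (ρ := ρ) wpreSetup hc2
      (c := { e with pc := some (pos + 2), mem := mem₁ }) rfl
    have hlen₃ : wpreSetup.length = 3 := rfl
    rw [hlen₃, execOps_wpreSetup hW hm₁8 hm₁9] at hr3
    set mem₅ : ℕ → ℕ := Function.update (Function.update mem₁ 16 (Qv W - 1)) 17 (3 * Qv W)
      with hmem₅def
    have hC : mem₅ 16 = Qv W - 1 := by
      rw [hmem₅def, Function.update_of_ne (by decide), Function.update_self]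
    have hPt : mem₅ 17 = 3 * Qv W := by rw [hmem₅def, Function.update_self]
    -- the zeroing loop: `Q - 1` cells from `3Q`
    have hrL := run_zeroLoop (P := P) (w := W) (O := O) (ρ := ρ) (i₀ := pos + 5) (RC := 16)
      (RP := 17) (by decide) hc3 (c := { e with pc := some (pos + 2 + 3), mem := mem₅ }) rfl hC hPt
      (Or.inl (by omega)) (Or.inl (by omega)) (by omega)
    set memL : ℕ → ℕ := zeroLoopResult 16 17 (3 * Qv W) (Qv W - 1) mem₅ with hmemLdef
    have hL17 : memL 17 = 4 * Qv W - 1 := by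
      rw [hmemLdef, zeroLoopResult_apply_pointer (RC := 16) (RP := 17) (by decide)]; omega
    -- the two closing operations
    have hrC := run_ops (P := P) (w := W) (O := O) (ρ := ρ) wpreClose hc4
      (c := { e with pc := some (pos + 5 + 5), mem := memL }) rfl
    have hlenC : wpreClose.length = 2 := rfl
    rw [hlenC, execOps_wpreClose hL17] at hrC
    set memF : ℕ → ℕ := Function.update (Function.update memL (4 * Qv W - 1) 0) 10 0 with hmemFdef
    -- values of `memF` outside the wiped cells
    have hFout : ∀ c, c ≠ 10 → c ≠ 16 → c ≠ 17 → ¬ (3 * Qv W ≤ c ∧ c < 4 * Qv W) →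
        memF c = mem₁ c := by
      intro c hc10 hc16 hc17 hc3Q
      rw [hmemFdef, Function.update_of_ne hc10, Function.update_of_ne (by omega), hmemLdef,
        zeroLoopResult_apply_of_ne hc16 hc17 (by omega), hmem₅def, Function.update_of_ne hc17,
        Function.update_of_ne hc16]
    refine ⟨1 + (1 + (3 + (5 * (Qv W - 1) + 1 + 2))), by simp only [wpreCost]; omega,
      { e with pc := some (pos + 5 + 5 + 2), mem := memF },
      run_add_of_run _ _ _ _ hr1 (run_add_of_run _ _ _ _ hr2
        (run_add_of_run _ _ _ _ hr3 (run_add_of_run _ _ _ _ hrL hrC))), ?_, ?_, ?_, ?_, rfl, rfl⟩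
    · show some (pos + 5 + 5 + 2) = some (pos + 12)
      congr 1
    · -- the new `B`-side between calls, at generation `0`
      refine ⟨0, by omega, ⟨?_, ?_, fun a ha => ?_⟩, ?_⟩
      · show memF 8 = 2 * Qv W
        rw [hFout 8 (by decide) (by decide) (by decide) (by omega), hm₁8]
      · show memF 9 = 3 * Qv W
        rw [hFout 9 (by decide) (by decide) (by decide) (by omega), hm₁9]
      · show memF (3 * Qv W + a) ≤ 0
        rw [hmemFdef, Function.update_of_ne (by omega)]
        rcases Nat.lt_or_ge a (Qv W - 1) with ha' | ha'
        · rw [Function.update_of_ne (by omega), hmemLdef,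
            zeroLoopResult_apply_of_mem (by omega) (by omega) ⟨by omega, by omega⟩]
        · rw [show 3 * Qv W + a = 4 * Qv W - 1 by omega, Function.update_self]
      · show memF 10 = 0
        rw [hmemFdef, Function.update_self]
    · -- the value bound
      intro a
      show memF a ≤ VT
      rcases eq_or_ne a 10 with rfl | ha10
      · rw [hmemFdef, Function.update_self]; omega
      rcases eq_or_ne a 16 with rfl | ha16
      · rw [hmemFdef, Function.update_of_ne ha10, Function.update_of_ne (by omega), hmemLdef,
          zeroLoopResult_apply_counter]; omega
      rcases eq_or_ne a 17 with rfl | ha17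
      · rw [hmemFdef, Function.update_of_ne ha10, Function.update_of_ne (by omega), hL17]; omega
      by_cases hseg : 3 * Qv W ≤ a ∧ a < 4 * Qv W
      · rw [hmemFdef, Function.update_of_ne ha10]
        rcases eq_or_ne a (4 * Qv W - 1) with rfl | ha4
        · rw [Function.update_self]; omega
        · rw [Function.update_of_ne ha4, hmemLdef,
            zeroLoopResult_apply_of_mem ha16 ha17 ⟨hseg.1, by omega⟩]; omega
      · rw [hFout a ha10 ha16 ha17 hseg]; exact hm₁T a
    · -- the frame
      intro c hc
      push Not at hc
      obtain ⟨hc10, hc15, hc16, hc17, hc3Q⟩ := hc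
      show memF c = e.mem c
      rw [hFout c hc10 hc16 hc17 (by omega), hmem₁, Function.update_of_ne hc15]
  · -- the skip branch
    have h15 : (Operand.dir 15).read mem₁ = 0 := by simp [hmem₁, hgQ]
    have hr2 : run P W O ρ 1 { e with pc := some (pos + 1), mem := mem₁ } =
        some { e with pc := some (pos + 12), mem := mem₁ } := by
      rw [run_one, step_jz_zero (i := pos + 1) rfl hjz h15]
    refine ⟨1 + 1, by simp only [wpreCost]; omega, { e with pc := some (pos + 12), mem := mem₁ },
      run_add_of_run _ _ _ _ hr1 hr2, rfl, ?_, hm₁T, ?_, rfl, rfl⟩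
    · refine ⟨g, by omega, ⟨hm₁8, hm₁9, fun a ha => ?_⟩, ?_⟩
      · show mem₁ (3 * Qv W + a) ≤ g
        rw [hmem₁, Function.update_of_ne (by omega)]
        exact hst a ha
      · show mem₁ 10 = g
        rw [hmem₁, Function.update_of_ne (by decide), h10]
    · intro c hc
      push Not at hc
      show mem₁ c = e.mem c
      rw [hmem₁, Function.update_of_ne hc.2.1]

end wpre

/-! ## The query block with wipe -/

/-- **The query block with wipe**: the wipe prefix followed by the query block proper of part II
(placed at `pos + 12`). [folklore] -/
def QB' (MB : Program) (kB pos : ℕ) (qa ql aa : Operand) : List Instr :=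
  WPRE pos ++ QB MB kB (pos + 12) qa ql aa

/-- The length of a query block with wipe. [folklore] -/
def qlenM' (MB : Program) : ℕ := 12 + qlenM MB

/-- Query blocks with wipe have the announced length. [folklore] -/
@[simp] theorem QB'_length (MB : Program) (kB pos : ℕ) (qa ql aa : Operand) :
    (QB' MB kB pos qa ql aa).length = qlenM' MB := by
  simp [QB', qlenM']

section qb

variable {W ws VT V : ℕ}

/-- **Specification of the query block with wipe.** As `run_QB`, but the `B`-side between calls may
be at any generation `g ≤ 2Q` (register `10`), no bound `g + 1 ≤ VT` is needed, and afterwards the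
`B`-side is between calls at some generation `≤ 2Q` again; the cost grows by `wpreCost W`. [folklore] -/
theorem run_QB' {P : Program} {MB : Program} {kB pos : ℕ} {qa ql aa : Operand}
    (hcode : CodeAt P pos (QB' MB kB pos qa ql aa)) (hws : ws < W) (hVT : VT + 1 = 2 ^ W)
    (hBdet : MB.IsDeterministic) (hBof : MB.IsOracleFree)
    {e : Cfg} (hpc : e.pc = some pos) {dmem : ℕ → ℕ} (hM : MSide W ws VT dmem e.mem)
    {g : ℕ} (hB : BPre W g e.mem) (h10 : e.mem 10 = g) (hg : g ≤ 2 * Qv W)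
    (hdm : MemLE V dmem) (hqa : qa.const ≤ V) (hql : ql.const ≤ V) (haa : aa.const ≤ V) (hV1 : 1 ≤ V)
    {oq : List ℕ} {sq : ℕ} {cB : Cfg}
    (hrunB : HaltsWithin MB (kB * inputWidth (readSeg dmem (qa.read dmem) (ql.read dmem))) noOracle
      zeroCoins (readSeg dmem (qa.read dmem) (ql.read dmem)) sq cB)
    (houtB : readOut cB.mem = oq) (hoV : oq.length ≤ V)
    (hVQ : 2 * V + 42 ≤ Qv W - 40) (hkB : kB * Nat.size V < W) {VB : ℕ}
    (hVB : 2 ^ (kB * Nat.size V) ≤ VB) (hMB : MB.maxConst ≤ VB) (hVBQ : VB < Qv W)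
    (O' : List ℕ → List ℕ) (ρ' : ℕ → ℕ) :
    ∃ n, n ≤ wpreCost W + qbCost (ql.read dmem) W sq oq.length ∧ ∃ e' : Cfg,
      run P W O' ρ' n e = some e' ∧ e'.pc = some (pos + qlenM' MB) ∧
      MSide W ws VT (writeSeg (Function.update dmem (aa.read dmem) (oq.map (· % 2 ^ ws)).length)
        (aa.read dmem + 1) (oq.map (· % 2 ^ ws))) e'.mem ∧
      (∃ g'', g'' ≤ 2 * Qv W ∧ (∃ wsB, BSide W g'' wsB VT cB.mem e'.mem) ∧ e'.mem 10 = g'') ∧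
      e'.coinPos = e.coinPos ∧ e'.queries = e.queries := by
  have hW : 8 ≤ W := eight_le_of_Qv (by omega)
  have hQ := Qv_ge hW
  have h4Q := four_mul_Qv (show 2 ≤ W by omega)
  obtain ⟨hcW, hcQ⟩ := codeAt_append_iff.1 (show CodeAt P pos (WPRE pos ++ QB MB kB (pos + 12) qa ql aa)
    from hcode)
  rw [WPRE_length] at hcQ
  -- the wipe prefix
  obtain ⟨n₁, hn₁, e₁, hrun₁, hpc₁, ⟨g', hg', hB₁, h10₁⟩, hT₁, hfr₁, hco₁, hq₁⟩ :=
    run_WPRE (P := P) (O := O') (ρ := ρ') hcW hW hVT hpc hM.1.memT hB h10 hg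
  have hM₁ : MSide W ws VT dmem e₁.mem :=
    hM.of_frame hW hT₁ fun c hc => hfr₁ c (by omega)
  -- the query block proper
  obtain ⟨n₂, hn₂, e₂, hrun₂, hpc₂, hM₂, hB₂, h10₂, hco₂, hq₂⟩ := run_QB (W := W) (ws := ws) (VT := VT)
    (V := V) hcQ hws hVT hBdet hBof hpc₁ hM₁ hB₁ h10₁ hdm hqa hql haa hV1 hrunB houtB hoV hVQ
    (by omega) hkB hVB hMB hVBQ O' ρ'
  refine ⟨n₁ + n₂, by omega, e₂, run_add_of_run _ _ _ _ hrun₁ hrun₂, ?_, hM₂,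
    ⟨g' + 1, by omega, hB₂, h10₂⟩, hco₂.trans hco₁, hq₂.trans hq₁⟩
  rw [hpc₂, qlenM']
  congr 1
  omega

end qb

/-! ## The simulating machine with wipes -/

/-- **The simulating machine with wipes**: prologue, the compiled `M` whose `query` blocks are the
query blocks with wipe `QB' M_B k_B`, epilogue. [folklore] -/
def SIM' (M : Program) (k : ℕ) (MB : Program) (kB : ℕ) : Program :=
  PRO k ++ compile LM (qlenM' MB) M 88 (QB' MB kB) ++ EPI (exitPos LM (qlenM' MB) M 88)

section structural

/-- The wipe prefix is plain. [folklore] -/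
theorem plain_of_mem_WPRE {pos : ℕ} {I : Instr} (h : I ∈ WPRE pos) : Instr.Plain I := by
  simp only [WPRE, zeroLoop, List.mem_append, List.mem_singleton] at h
  rcases h with (((h | rfl) | h) | h) | h
  exacts [plain_of_mem_map h, ⟨rfl, rfl⟩, plain_of_mem_map h, plain_of_mem_loopBlock h,
    plain_of_mem_map h]

/-- Query blocks with wipe are plain. [folklore] -/
theorem plain_of_mem_QB' {MB : Program} {kB pos : ℕ} {qa ql aa : Operand} {I : Instr}
    (h : I ∈ QB' MB kB pos qa ql aa) : Instr.Plain I := by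
  simp only [QB', List.mem_append] at h
  rcases h with h | h
  exacts [plain_of_mem_WPRE h, plain_of_mem_QB h]

/-- Every instruction of the simulating machine with wipes is plain. [folklore] -/
theorem plain_of_mem_SIM' {M : Program} {k : ℕ} {MB : Program} {kB : ℕ} {I : Instr}
    (h : I ∈ SIM' M k MB kB) : Instr.Plain I := by
  simp only [SIM', List.mem_append] at h
  rcases h with (h | h) | h
  exacts [plain_of_mem_PRO h, plain_of_mem_compile (fun _ _ _ _ _ hI => plain_of_mem_QB' hI) h,
    plain_of_mem_EPI h]

/-- **The simulating machine with wipes is deterministic.** [folklore] -/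
theorem SIM'_isDeterministic (M : Program) (k : ℕ) (MB : Program) (kB : ℕ) :
    (SIM' M k MB kB).IsDeterministic := fun _ h => (plain_of_mem_SIM' h).1

/-- **The simulating machine with wipes is oracle-free.** [folklore] -/
theorem SIM'_isOracleFree (M : Program) (k : ℕ) (MB : Program) (kB : ℕ) :
    (SIM' M k MB kB).IsOracleFree := fun _ h => (plain_of_mem_SIM' h).2

/-- Placement of the three parts of the simulating machine with wipes. [folklore] -/
theorem codeAt_SIM' (M : Program) (k : ℕ) (MB : Program) (kB : ℕ) :
    CodeAt (SIM' M k MB kB) 0 (PRO k) ∧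
      CodeAt (SIM' M k MB kB) 88 (compile LM (qlenM' MB) M 88 (QB' MB kB)) ∧
      CodeAt (SIM' M k MB kB) (exitPos LM (qlenM' MB) M 88) (EPI (exitPos LM (qlenM' MB) M 88)) := by
  have h := codeAt_self (SIM' M k MB kB)
  conv at h => arg 3; rw [SIM']
  obtain ⟨h12, h3⟩ := codeAt_append_iff.1 h
  obtain ⟨h1, h2⟩ := codeAt_append_iff.1 h12
  simp only [PRO_length, Nat.zero_add, List.length_append] at h2 h3
  have hlen := length_compile (L := LM) (qlen := qlenM' MB) (M := M) (base := 88) (qb := QB' MB kB)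
    (fun pos qa ql aa => QB'_length MB kB pos qa ql aa)
  rw [show 88 + (compile LM (qlenM' MB) M 88 (QB' MB kB)).length = exitPos LM (qlenM' MB) M 88
    by omega] at h3
  exact ⟨h1, h2, h3⟩

end structural

/-! ## The simulation invariant and one step of the reduction -/

section sim

variable {M MB : Program} {k kB W ws VT V VB : ℕ} {P : Program}

/-- The cost charged to a query `q` by the machine with wipes: a wipe plus its query block. [folklore] -/
def charge' (W : ℕ) (O : List ℕ → List ℕ) (s : List ℕ → ℕ) (q : List ℕ) : ℕ :=
  wpreCost W + qbCost q.length W (s q) (O q).length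

/-- **The simulation invariant with wipes**: the emulation relation of `M`, and the `B`-side between
calls at SOME generation `g ≤ 2Q` held in register `10` (no longer the number of queries). [folklore] -/
def SimInv' (W ws VT : ℕ) (M MB : Program) (d e : Cfg) : Prop :=
  ERel LM (EM W ws) VT M 88 (qlenM' MB) d e ∧ ∃ g, g ≤ 2 * Qv W ∧ BPre W g e.mem ∧ e.mem 10 = g

/-- **One step of the reduction, simulated (machine with wipes).** As `sim_step`, without the bound
on the number of queries. [folklore] -/
theorem sim_step' (hcode : CodeAt P 88 (compile LM (qlenM' MB) M 88 (QB' MB kB)))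
    (hws : ws < W) (hVT : VT + 1 = 2 ^ W)
    (hdet : M.IsDeterministic) (hBdet : MB.IsDeterministic) (hBof : MB.IsOracleFree)
    (hMV : Program.maxConst M ≤ V) (hV1 : 1 ≤ V) (hVQ : 2 * V + 42 ≤ Qv W - 40)
    (hkB : kB * Nat.size V < W) (hVB : 2 ^ (kB * Nat.size V) ≤ VB) (hMBc : Program.maxConst MB ≤ VB)
    (hVBQ : VB < Qv W)
    {O : List ℕ → List ℕ} {s : List ℕ → ℕ} {d d' e : Cfg} (hinv : SimInv' W ws VT M MB d e)
    (hdm : MemLE V d.mem) (hstep : step M ws O zeroCoins d = some d')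
    (hO : ∀ q ∈ d'.queries, (O q).length ≤ V)
    (hMB : ∀ q ∈ d'.queries, ∃ cB, HaltsWithin MB (kB * inputWidth q) noOracle zeroCoins q (s q) cB ∧
      readOut cB.mem = O q)
    (O' : List ℕ → List ℕ) (ρ' : ℕ → ℕ) :
    ∃ n e', run P W O' ρ' n e = some e' ∧ SimInv' W ws VT M MB d' e' ∧
      n + (d.queries.map (charge' W O s)).sum ≤ cstep + (d'.queries.map (charge' W O s)).sum := by
  have hW : 8 ≤ W := eight_le_of_Qv (by omega)
  have hQ := Qv_ge hW
  have h4Q := four_mul_Qv (show 2 ≤ W by omega)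
  have hVT1 : 1 ≤ VT := by
    have : 2 ^ 8 ≤ 2 ^ W := Nat.pow_le_pow_right (by omega) hW
    omega
  have hVVT : V ≤ VT := by omega
  have hOKM := envOK_M hW hws.le
  have hqb : ∀ pos qa ql aa, (QB' MB kB pos qa ql aa).length = qlenM' MB :=
    fun pos qa ql aa => QB'_length MB kB pos qa ql aa
  obtain ⟨hrel, g, hg, hpre, h10⟩ := hinv
  -- is the source step a query?
  by_cases hnq : ∀ i qa ql aa, d.pc = some i → M[i]? ≠ some (.query qa ql aa)
  · -- ordinary instruction: the emulator step
    obtain ⟨n, hn, e', hrun, hrel', -, -, hfr⟩ := emu_step (L := LM) (E := EM W ws) hOKM hVT hVT1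
      (LM_regs_le (by omega)) hqb hcode hdet hMV (by simp only [EM_Q]; omega) hVVT O' ρ' hrel hdm
      hstep hnq
    have hqs : d'.queries = d.queries := by
      rcases step_queries hstep with h | ⟨i, qa, ql, aa, hpc, hMi, -⟩
      · exact h
      · exact absurd hMi (hnq i qa ql aa hpc)
    refine ⟨n, e', hrun, ⟨hrel', g, hg, ?_, ?_⟩, by rw [hqs]; omega⟩
    · exact hpre.of_frame fun c hc => hfr c fun hf => by have := foot_M hW hf; omega
    · rw [hfr 10 fun hf => by have := foot_M hW hf; omega, h10]
  · -- a query: the query block with wipe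
    simp only [not_forall, not_not, exists_prop] at hnq
    obtain ⟨i, qa, ql, aa, hpc, hMi⟩ := hnq
    have hi : i < M.length := (List.getElem?_eq_some_iff.1 hMi).1
    rw [step_query hpc hMi] at hstep
    simp only [Option.some.injEq] at hstep
    subst hstep
    simp only at hO hMB ⊢
    have hqmem : readSeg d.mem (qa.read d.mem) (ql.read d.mem) ∈
        d.queries ++ [readSeg d.mem (qa.read d.mem) (ql.read d.mem)] :=
      List.mem_append_right _ (List.mem_singleton_self _)
    obtain ⟨cB, hrunB, houtB⟩ := hMB _ hqmem
    have hoV := hO _ hqmem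
    -- constants of the query instruction
    have hIc : (Instr.query qa ql aa).maxConst ≤ V := le_trans (Instr.maxConst_le_of_getElem? hMi) hMV
    simp only [Instr.maxConst, max_le_iff] at hIc
    -- placement of the query block
    have hblk := codeAt_blkAt (L := LM) (qlen := qlenM' MB) (base := 88) (qb := QB' MB kB) hqb hcode hi
    simp only [blkAt, hMi] at hblk
    have hpce : e.pc = some (bstart LM (qlenM' MB) M 88 i) := by rw [hrel.pc, hpc]; rfl
    obtain ⟨n, hn, e', hrun, hpc', hM', ⟨g'', hg'', ⟨wsB, hB'⟩, h10'⟩, -, -⟩ := run_QB' (W := W)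
      (ws := ws) (VT := VT) (V := V) hblk hws hVT hBdet hBof hpce ⟨hrel.inv, hrel.agree⟩ hpre h10 hg
      hdm hIc.1 hIc.2.1 hIc.2.2 hV1 hrunB houtB hoV hVQ hkB hVB hMBc hVBQ O' ρ'
    refine ⟨n, e', hrun, ⟨⟨?_, hM'.2, hM'.1⟩, g'', hg'', hB'.bpre, h10'⟩, ?_⟩
    · rw [hpc']
      simp only [Option.getD_some]
      rw [bstart_succ hi]
      simp [blkLenAt, hMi, blkLen]
    · simp only [List.map_append, List.map_cons, List.map_nil, List.sum_append, List.sum_cons,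
        List.sum_nil, Nat.add_zero, charge', readSeg_length]
      have : cstep = 38 := rfl
      omega

/-- **The run of the reduction, simulated (machine with wipes).** [folklore] -/
theorem sim_run' (hcode : CodeAt P 88 (compile LM (qlenM' MB) M 88 (QB' MB kB)))
    (hws : ws < W) (hVT : VT + 1 = 2 ^ W)
    (hdet : M.IsDeterministic) (hBdet : MB.IsDeterministic) (hBof : MB.IsOracleFree)
    (hMV : Program.maxConst M ≤ V) (hV1 : 1 ≤ V) (hwsV : 2 ^ ws - 1 ≤ V) (hVQ : 2 * V + 42 ≤ Qv W - 40)
    (hkB : kB * Nat.size V < W) (hVB : 2 ^ (kB * Nat.size V) ≤ VB) (hMBc : Program.maxConst MB ≤ VB)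
    (hVBQ : VB < Qv W)
    {O : List ℕ → List ℕ} {s : List ℕ → ℕ} {d₀ e₀ : Cfg} (hinv : SimInv' W ws VT M MB d₀ e₀)
    (hdm : MemLE V d₀.mem) (O' : List ℕ → List ℕ) (ρ' : ℕ → ℕ) :
    ∀ (n : ℕ) {dn : Cfg}, run M ws O zeroCoins n d₀ = some dn →
      (∀ q ∈ dn.queries, (O q).length ≤ V) →
      (∀ q ∈ dn.queries, ∃ cB, HaltsWithin MB (kB * inputWidth q) noOracle zeroCoins q (s q) cB ∧
        readOut cB.mem = O q) →
      ∃ m en, run P W O' ρ' m e₀ = some en ∧ SimInv' W ws VT M MB dn en ∧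
        m + (d₀.queries.map (charge' W O s)).sum ≤ cstep * n + (dn.queries.map (charge' W O s)).sum
  | 0, dn, h, _, _ => by
      simp only [run_zero, Option.some.injEq] at h
      subst h
      exact ⟨0, e₀, rfl, hinv, by simp⟩
  | n + 1, dn, h, hO, hMB => by
      rw [run_add, Option.bind_eq_some_iff] at h
      obtain ⟨dm, hdm', hlast⟩ := h
      rw [run_one] at hlast
      have hpre := step_queries_prefix hlast
      obtain ⟨m, em, hrun, hinvm, hcost⟩ := sim_run' hcode hws hVT hdet hBdet hBof hMV hV1 hwsV hVQ
        hkB hVB hMBc hVBQ hinv hdm O' ρ' n hdm' (fun q hq => hO q (hpre.subset hq))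
        fun q hq => hMB q (hpre.subset hq)
      have hmemm : MemLE V dm.mem :=
        run_memLE_of_queries hwsV hV1 hMV n hdm hdm' fun q hq => hO q (hpre.subset hq)
      obtain ⟨m', e', hrun', hinv', hcost'⟩ := sim_step' hcode hws hVT hdet hBdet hBof hMV hV1 hVQ
        hkB hVB hMBc hVBQ hinvm hmemm hlast hO hMB O' ρ'
      exact ⟨m + m', e', run_add_of_run _ _ _ _ hrun hrun', hinv', by rw [Nat.mul_succ]; omega⟩

/-! ## The whole simulation -/

/-- The cost of the simulating machine with wipes. [folklore] -/
def simCost' (L W t : ℕ) (charges : ℕ) (ℓ : ℕ) : ℕ :=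
  proCost L W + cstep * t + charges + epiCost ℓ

/-- **Specification of the simulating machine with wipes.** As `run_SIM`, WITHOUT the hypothesis
`t + 2 ≤ 2 ^ W`: the reduction may run, and query, for any number of steps. [folklore] -/
theorem run_SIM' (hdet : M.IsDeterministic) (hBdet : MB.IsDeterministic) (hBof : MB.IsOracleFree)
    {x : List ℕ} (hw : inputWidth x ≤ W) (hk : k * inputWidth x < W)
    (hL : x.length + 83 ≤ Qv W)
    (hMV : Program.maxConst M ≤ V) (hV1 : 1 ≤ V) (hwsV : 2 ^ (k * inputWidth x) - 1 ≤ V)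
    (hVQ : 2 * V + 121 ≤ Qv W - 40)
    (hkB : kB * Nat.size V < W) (hVB : 2 ^ (kB * Nat.size V) ≤ VB) (hMBc : Program.maxConst MB ≤ VB)
    (hVBQ : VB < Qv W)
    {O : List ℕ → List ℕ} {t : ℕ} {cM : Cfg} (hM : HaltsWithin M (k * inputWidth x) O zeroCoins x t cM)
    (hO : ∀ q ∈ cM.queries, (O q).length ≤ V) {s : List ℕ → ℕ}
    (hMB : ∀ q ∈ cM.queries, ∃ cB, HaltsWithin MB (kB * inputWidth q) noOracle zeroCoins q (s q) cB ∧
      readOut cB.mem = O q)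
    (O' : List ℕ → List ℕ) (ρ' : ℕ → ℕ) :
    ∃ n c', run (SIM' M k MB kB) W O' ρ' n (init W x) = some c' ∧ c'.pc = none ∧
      readOut c'.mem = readOut cM.mem ∧
      n ≤ simCost' x.length W t ((cM.queries.map (charge' W O s)).sum) (readOut cM.mem).length := by
  have hW : 8 ≤ W := eight_le_of_Qv (by omega)
  have hQ := Qv_ge hW
  have h4Q := four_mul_Qv (show 2 ≤ W by omega)
  set ws := k * inputWidth x with hws
  set VT := 2 ^ W - 1 with hVTdef
  have hVT : VT + 1 = 2 ^ W := by
    have : 1 ≤ 2 ^ W := Nat.one_le_two_pow; omega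
  obtain ⟨cPRO, cCMP, cEPI⟩ := codeAt_SIM' M k MB kB
  -- the prologue
  obtain ⟨n₁, hn₁, mem₁, r₁, hreg, hzero, e4, e5, e6, e7, e8, e9, e10, hword⟩ :=
    run_PRO (P := SIM' M k MB kB) (O := O') (ρ := ρ') cPRO hw hk hL
  -- the initial invariant
  have hst : StampLE (EM W ws) mem₁ := fun a ha => by
    simp only [EM_Sv, EM_Gv]; rw [hzero _ (by omega)]
  have hT₁ : MemLE VT mem₁ := fun a => by have := hword a; omega
  have hpre₁ : BPre W 0 mem₁ := ⟨e8, e9, fun a ha => by rw [hzero _ (by omega)]⟩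
  have hinv₀ : SimInv' W ws VT M MB (init ws x) ⟨some 88, mem₁, 0, []⟩ := by
    refine ⟨⟨?_, fun a ha => ?_, ⟨⟨e4, e5, e6, e7⟩, hst, hT₁⟩⟩, 0, by omega, by simpa using hpre₁,
      by simpa using e10⟩
    · simp [bstart_zero]
    · simp only [EM_Q] at ha
      show edec (EM W ws) mem₁ a = (init ws x).mem a
      rw [edec_M_eq hst ha, hreg a ha]
  -- the run of the reduction
  obtain ⟨nM, hnM, hrunM, hstepM⟩ := hM.exists_run
  have hhalt : cM.pc = none := (step_eq_none_iff _ _ _ _ _).1 hstepM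
  obtain ⟨n₂, e₂, r₂, ⟨hrel₂, g₂, -, hpre₂, -⟩, hcost₂⟩ := sim_run' (P := SIM' M k MB kB) cCMP hk hVT
    hdet hBdet hBof hMV hV1 hwsV (by omega) hkB hVB hMBc hVBQ hinv₀ (init_memLE ws x hwsV) O' ρ' nM
    hrunM hO hMB
  have hmemM : MemLE V cM.mem := run_memLE_of_queries hwsV hV1 hMV nM (init_memLE ws x hwsV) hrunM hO
  -- the epilogue
  have hpc₂ : e₂.pc = some (exitPos LM (qlenM' MB) M 88) := by
    rw [hrel₂.pc, hhalt, Option.getD_none, exitPos]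
  have h40 : e₂.mem 40 = cM.mem 0 := by
    have := hrel₂.agree 0 (by simp only [EM_Q]; omega)
    rwa [edec_M_eq hrel₂.inv.stamp (by omega), Nat.add_zero] at this
  have hℓ : cM.mem 0 ≤ V := hmemM 0
  obtain ⟨n₃, hn₃, c', r₃, hpc₃, -, -, h0, hout⟩ := run_EPI (P := SIM' M k MB kB) (O := O') (ρ := ρ')
    cEPI hpc₂ (fun a => by have := hrel₂.inv.memT a; omega) hpre₂.1 h40 (by omega)
  refine ⟨n₁ + (n₂ + n₃), c', run_add_of_run _ _ _ _ r₁ (run_add_of_run _ _ _ _ r₂ r₃), hpc₃, ?_, ?_⟩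
  · simp only [readOut, h0]
    refine readSeg_congr fun j hj => ?_
    rw [hout (1 + j) (by omega) (by omega), show 40 + (1 + j) = 40 + (1 + j) from rfl]
    have := hrel₂.agree (1 + j) (by simp only [EM_Q]; omega)
    rwa [edec_M_eq hrel₂.inv.stamp (by omega)] at this
  · simp only [simCost', readOut_length, List.map_nil, List.sum_nil, Nat.add_zero, init_queries]
      at hcost₂ ⊢
    have := Nat.mul_le_mul_left cstep hnM
    omega

/-- **The simulating machine with wipes outputs what the reduction outputs**, within `T` steps for
any `T ≥ simCost' …` (packaged as `OutputsWithin`). [folklore] -/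
theorem outputsWithin_SIM' (hdet : M.IsDeterministic) (hBdet : MB.IsDeterministic)
    (hBof : MB.IsOracleFree)
    {x : List ℕ} (hw : inputWidth x ≤ W) (hk : k * inputWidth x < W)
    (hL : x.length + 83 ≤ Qv W)
    (hMV : Program.maxConst M ≤ V) (hV1 : 1 ≤ V) (hwsV : 2 ^ (k * inputWidth x) - 1 ≤ V)
    (hVQ : 2 * V + 121 ≤ Qv W - 40)
    (hkB : kB * Nat.size V < W) (hVB : 2 ^ (kB * Nat.size V) ≤ VB) (hMBc : Program.maxConst MB ≤ VB)
    (hVBQ : VB < Qv W)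
    {O : List ℕ → List ℕ} {t : ℕ} {cM : Cfg} (hM : HaltsWithin M (k * inputWidth x) O zeroCoins x t cM)
    (hO : ∀ q ∈ cM.queries, (O q).length ≤ V) {s : List ℕ → ℕ}
    (hMB : ∀ q ∈ cM.queries, ∃ cB, HaltsWithin MB (kB * inputWidth q) noOracle zeroCoins q (s q) cB ∧
      readOut cB.mem = O q)
    (O' : List ℕ → List ℕ) (ρ' : ℕ → ℕ) {T : ℕ}
    (hT : simCost' x.length W t ((cM.queries.map (charge' W O s)).sum) (readOut cM.mem).length ≤ T) :
    OutputsWithin (SIM' M k MB kB) W O' ρ' x (readOut cM.mem) T := by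
  obtain ⟨n, c', hrun, hpc, hout, hn⟩ := run_SIM' hdet hBdet hBof hw hk hL hMV hV1 hwsV hVQ hkB hVB
    hMBc hVBQ hM hO hMB O' ρ'
  rw [← hout]
  exact outputsWithin_of_run hrun ((step_eq_none_iff _ _ _ _ _).2 hpc) (hn.trans hT)

/-- The same, as a `HaltsWithin` certificate with the output named (the form consumed by oracle-RAM
time predicates such as `CNFSATInThreeSumOracleRAMTime`). [folklore] -/
theorem haltsWithin_SIM' (hdet : M.IsDeterministic) (hBdet : MB.IsDeterministic)
    (hBof : MB.IsOracleFree)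
    {x : List ℕ} (hw : inputWidth x ≤ W) (hk : k * inputWidth x < W)
    (hL : x.length + 83 ≤ Qv W)
    (hMV : Program.maxConst M ≤ V) (hV1 : 1 ≤ V) (hwsV : 2 ^ (k * inputWidth x) - 1 ≤ V)
    (hVQ : 2 * V + 121 ≤ Qv W - 40)
    (hkB : kB * Nat.size V < W) (hVB : 2 ^ (kB * Nat.size V) ≤ VB) (hMBc : Program.maxConst MB ≤ VB)
    (hVBQ : VB < Qv W)
    {O : List ℕ → List ℕ} {t : ℕ} {cM : Cfg} (hM : HaltsWithin M (k * inputWidth x) O zeroCoins x t cM)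
    (hO : ∀ q ∈ cM.queries, (O q).length ≤ V) {s : List ℕ → ℕ}
    (hMB : ∀ q ∈ cM.queries, ∃ cB, HaltsWithin MB (kB * inputWidth q) noOracle zeroCoins q (s q) cB ∧
      readOut cB.mem = O q)
    (O' : List ℕ → List ℕ) (ρ' : ℕ → ℕ) {T : ℕ}
    (hT : simCost' x.length W t ((cM.queries.map (charge' W O s)).sum) (readOut cM.mem).length ≤ T) :
    ∃ c', HaltsWithin (SIM' M k MB kB) W O' ρ' x T c' ∧ readOut c'.mem = readOut cM.mem := by
  obtain ⟨n, c', hrun, hpc, hout, hn⟩ := run_SIM' hdet hBdet hBof hw hk hL hMV hV1 hwsV hVQ hkB hVB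
    hMBc hVBQ hM hO hMB O' ρ'
  exact ⟨c', haltsWithin_of_run hrun ((step_eq_none_iff _ _ _ _ _).2 hpc) (hn.trans hT), hout⟩

end sim

end Inline

end Literature.Computability.Cryptography.WordRAM
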